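import Mathlib
import Summits.ABC.ABC.Theorems.ThreeSlotZooSquareSquare
import Summits.ABC.ABC.Theorems.IneffectiveSubspaceUniformSadicTowerFourThreeSlotQuasiPolynomial
import Literature.NumberTheory.DiophantineGeometry.PastenSubexpTheorem14

/-!
# Shapes of the three-prime cell and the even-pair case of `ZooSorting`

Support for `ZooSorting` (stmt-ABC-24024) on `route-ABC-ThreeSlotCyclotomicDescent`.

* `eq_minFac_pow_log`: a prime power `n` is `n.minFac ^ (Nat.log n.minFac n)` — the route's typed
  exponent `Nat.log n.minFac n` IS the exponent and `n.minFac` the prime.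
* `threePP_shape`: an abc triple with `ω(abc) ≤ 3` and `a, b ≥ 2` is `p^x + q^y = r^z` with distinct
  primes `p = a.minFac, q = b.minFac, r = c.minFac` and exponents `x, y, z ≥ 1` equal to the typed ones.
* `evenPair_le_two_rad`: if the exponent of `c` and the exponent of `a` or of `b` are both even, then
  `c ≤ 2 · rad(abc)` — by the landed complete solution `ThreeSlotZooSquareSquare.squareSquareZoo` of
  `p^(2u) + q^y = r^(2m)`. This is the statement of the birth-skeleton stub `stub_threePP_evenPair`
  (with the stronger constant 2 in place of 5 and without the family disjuncts).
-/

namespace Summit.ABC.ABC.Theorems.ThreeSlotShapes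

open Literature.NumberTheory.DiophantineGeometry (IsABCTriple rad rad_def rad_swap)
open Literature.NumberTheory.DiophantineGeometry.Pasten (coprime_left_of_isABCTriple
  coprime_right_of_isABCTriple)
open Summit.ABC.ABC.Theorems.UniformSadicTowerFour.ThreeSlotWall (card_primeFactors_eq_one_of_le_three)

/-- The least prime factor of a prime power `p ^ k` (`k ≥ 1`) is `p`. [folklore] -/
theorem minFac_prime_pow {p k : ℕ} (hp : p.Prime) (hk : 1 ≤ k) : (p ^ k).minFac = p := by
  have hne : p ^ k ≠ 1 := by
    intro h
    have := (Nat.pow_eq_one.mp h)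
    rcases this with h1 | h0
    · exact hp.one_lt.ne' h1
    · omega
  have hmin : (p ^ k).minFac.Prime := Nat.minFac_prime hne
  have hdvd : (p ^ k).minFac ∣ p := hmin.dvd_of_dvd_pow (Nat.minFac_dvd _)
  exact (Nat.prime_dvd_prime_iff_eq hmin hp).mp hdvd

/-- A prime power is `minFac ^ (log_minFac)`: for `n = p^k`, `n.minFac = p` and
`Nat.log n.minFac n = k`. [folklore] -/
theorem eq_minFac_pow_log {n : ℕ} (hn : IsPrimePow n) :
    n.minFac.Prime ∧ 1 ≤ Nat.log n.minFac n ∧ n = n.minFac ^ Nat.log n.minFac n := by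
  obtain ⟨p, k, hp, hk, rfl⟩ := (isPrimePow_nat_iff _).mp hn
  have hmf : (p ^ k).minFac = p := minFac_prime_pow hp hk
  rw [hmf, Nat.log_pow hp.one_lt]
  exact ⟨hp, hk, rfl⟩

/-- A natural number with exactly one prime factor is a prime power. [folklore] -/
theorem isPrimePow_of_card_primeFactors_eq_one {n : ℕ} (h : n.primeFactors.card = 1) :
    IsPrimePow n :=
  isPrimePow_iff_card_primeFactors_eq_one.mpr h

/-- **Shape of the three-prime cell.** An abc triple with `ω(abc) ≤ 3` and `a, b ≥ 2` reads
`p^x + q^y = r^z` with `p = a.minFac`, `q = b.minFac`, `r = c.minFac` distinct primes and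
`x = log_p a`, `y = log_q b`, `z = log_r c` all `≥ 1`. [folklore] -/
theorem threePP_shape {a b c : ℕ} (h : IsABCTriple a b c) (hω : (a * b * c).primeFactors.card ≤ 3)
    (ha : 2 ≤ a) (hb : 2 ≤ b) :
    a.minFac.Prime ∧ b.minFac.Prime ∧ c.minFac.Prime ∧
    a.minFac ≠ b.minFac ∧ a.minFac ≠ c.minFac ∧ b.minFac ≠ c.minFac ∧
    1 ≤ Nat.log a.minFac a ∧ 1 ≤ Nat.log b.minFac b ∧ 1 ≤ Nat.log c.minFac c ∧
    a = a.minFac ^ Nat.log a.minFac a ∧ b = b.minFac ^ Nat.log b.minFac b ∧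
    c = c.minFac ^ Nat.log c.minFac c := by
  obtain ⟨h1a, h1b, h1c⟩ := card_primeFactors_eq_one_of_le_three h ha hb hω
  obtain ⟨hpa, hxa, hea⟩ := eq_minFac_pow_log (isPrimePow_of_card_primeFactors_eq_one h1a)
  obtain ⟨hpb, hxb, heb⟩ := eq_minFac_pow_log (isPrimePow_of_card_primeFactors_eq_one h1b)
  obtain ⟨hpc, hxc, hec⟩ := eq_minFac_pow_log (isPrimePow_of_card_primeFactors_eq_one h1c)
  have hab : a.Coprime b := h.2.2.2
  have hac : a.Coprime c := coprime_left_of_isABCTriple h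
  have hbc : b.Coprime c := coprime_right_of_isABCTriple h
  have key : ∀ {m n : ℕ}, m.Coprime n → m.minFac.Prime → m.minFac ≠ n.minFac := by
    intro m n hmn hpm heq
    have h1 : m.minFac ∣ m := Nat.minFac_dvd m
    have h2 : m.minFac ∣ n := heq ▸ Nat.minFac_dvd n
    have := Nat.eq_one_of_dvd_coprimes hmn h1 h2
    exact hpm.one_lt.ne' this
  exact ⟨hpa, hpb, hpc, key hab hpa, key hac hpa, key hbc hpb, hxa, hxb, hxc, hea, heb, hec⟩

/-- **The even-pair case of `ZooSorting`** (birth stub `stub_threePP_evenPair`, constant sharpened to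
`2`): if `a, b ≥ 2`, `ω(abc) ≤ 3`, and the exponent of `c` is even together with the exponent of `a`
or of `b`, then `c ≤ 2 · rad(abc)`. Proof: the shape is `p^(2u) + q^y = r^(2m)` (or its mirror), whose
complete solution list `ThreeSlotZooSquareSquare.squareSquareZoo` gives the bound. -/
theorem evenPair_le_two_rad : ∀ a b c : ℕ, IsABCTriple a b c → (a * b * c).primeFactors.card ≤ 3 →
    2 ≤ a → 2 ≤ b →
    (2 ∣ Nat.log c.minFac c ∧ (2 ∣ Nat.log a.minFac a ∨ 2 ∣ Nat.log b.minFac b)) →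
    c ≤ 2 * rad a b c := by
  intro a b c h hω ha hb hev
  obtain ⟨hpa, hpb, hpc, hab, -, -, hxa, hxb, hxc, hea, heb, hec⟩ := threePP_shape h hω ha hb
  obtain ⟨hz, hx | hy⟩ := hev
  · -- exponents of `a` and `c` even: `p^(2u) + q^y = r^(2m)`
    obtain ⟨m, hm⟩ := hz
    obtain ⟨u, hu⟩ := hx
    have hu1 : 1 ≤ u := by omega
    have hm1 : 1 ≤ m := by omega
    have heq : a.minFac ^ (2 * u) + b.minFac ^ Nat.log b.minFac b = c.minFac ^ (2 * m) := by
      rw [← hu, ← hm, ← hea, ← heb, ← hec]; exact h.2.2.1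
    have := Summit.ABC.ABC.Theorems.ThreeSlotZooSquareSquare.squareSquareZoo a.minFac b.minFac
      c.minFac u m (Nat.log b.minFac b) hpa hpb hpc hab hu1 hm1 hxb heq
    rw [← hu, ← hm, ← hea, ← heb, ← hec] at this
    exact this
  · -- exponents of `b` and `c` even: mirror, `q^(2v) + p^x = r^(2m)`
    obtain ⟨m, hm⟩ := hz
    obtain ⟨v, hv⟩ := hy
    have hv1 : 1 ≤ v := by omega
    have hm1 : 1 ≤ m := by omega
    have heq : b.minFac ^ (2 * v) + a.minFac ^ Nat.log a.minFac a = c.minFac ^ (2 * m) := by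
      rw [← hv, ← hm, ← hea, ← heb, ← hec]; have := h.2.2.1; omega
    have := Summit.ABC.ABC.Theorems.ThreeSlotZooSquareSquare.squareSquareZoo b.minFac a.minFac
      c.minFac v m (Nat.log a.minFac a) hpb hpa hpc hab.symm hv1 hm1 hxa heq
    rw [← hv, ← hm, ← hea, ← heb, ← hec, rad_swap] at this
    exact this

end Summit.ABC.ABC.Theorems.ThreeSlotShapes
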